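import Summits.QuantumFields.BalabanUV.Beta.WardMixedModelNoGo

/-!
# `BalabanUV.Beta.WardMixedConsistency` — binder row D1, (L4): **THE MIXED-SOCKET CONSISTENCY IDENTITY HOLDS** — the block Ward divergence of the
# first-order mixed contact `Dmix_α` equals the reflection defect of the hW mixed datum `[M1At 0, D_Y]`
# (β sub-cell, D1 formalisation swarm, unit `b2b-balaban-beta-d1-formalise-leaf-06`, gen 4; «D1-hRhW-MIXED-JOINT-MODEL» part B)

HONEST FRAMING (cell charter, verbatim): «discharging `BetaPertH` makes Bałaban's UV stability UNCONDITIONAL — a real constructive-QFT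
result; it is NOT the continuum limit and NOT the Clay problem.»  HONEST DEPENDENCY (verbatim): «continuum YM on T⁴ ⇐ BetaPertH ∧ nine spine
estimates (0/9 proved); BetaPertH ⇐ (D1) ∧ (D4) ∧ CAP+tail; G-an2-4 gates asym, D1 and NE2/3/4.»  [folklore] field-leg Kronecker algebra of the
row-D1 owner's mixed contact `Dmix` (K-M1 `SecondOrderMixedModel` p222594), an1's pure-sign law of the rooted W-Hessian (`hessFFAt_act_apply`) and an5's
block reflection bookkeeping (`sref_block`, `sum_box_bflip`) BY NAME.  No statement of Bałaban's papers, no `[cite:]`, no `def`, no `def … : Prop`;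
instantiates NO binder of the β-function wall (0/4: hW, hR, D1Tel, D1Rep).  NOT hW, NOT hR, NOT D1, NOT `BetaPertH`, NOT continuum, NOT Clay.

WHAT (`d + 1 = 4`, odd `Lc`, centred root `ρ_c = toSite (ctrOff 4 Lc)`, `H_{ρ′w} := hessFFAt ρ_c Lc ρ′ w`).  leaf-04's junction algebra
(`WardBorderReflection.joint_consistency_necessary` ∕ `ward_stepB`, p223076) says: a table solving BOTH the axis-`α` reflection letter `actB_α T − T = B_α`
AND a block Ward letter `s • Σ_v divV (κ u ↦ c • T κ u ρ′ w) (Lc•Y + v) = F Y ρ′ w` exists only if, and — given a Ward solution — as soon as,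
`s • Σ_v divV (κ u ↦ c • B_α κ u ρ′ w) (Lc•Y + v) = ε_α(ρ′) • refK_α (F (sref α Y) ρ′ (bref α ρ′ w)) − F Y ρ′ w`.  For the MIXED sockets of the
row (hR: `SecondOrderLetterLevels.MixedPrim`, contact `B_α := Dmix_α`; hW: `WardLocusParityLevels.…_TW_su_exact₀`'s hM₂0, datum
`F Y ρ′ w := [M1At 0 ρ′ w, D_Y]`, `D_Y = diagK (½ • Σ_v legInd ρ_c (Lc•Y + v))`, `s = (stepScale 0·Lc⁴)⁻¹`, `c = wM2 0`) THIS IDENTITY IS TRUE: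
* §1 `sum_box_indicator_sref`, `sum_box_indicator_bref`: the block indicator read at a reflected field leg — `Σ_v [bref α β x = Lc•sref α Y + v]` is
  `Σ_v [x = Lc•Y + v]` for `β ≠ α` and `Σ_v [x + e_α = Lc•Y + v]` for `β = α` (the reflected `α`-bond is re-based at its other endpoint: leaf-04's FACE LAYER).
* §2 `Dmix_eq_zero_*`, `wardOp_Dmix_inl_inl`: the block Ward divergence of `Dmix_α` vanishes off the ff block and is
  `(cΛ∕2) · H · ([β′ = α](A_z − I_z) − [β = α](A_x − I_x))` on it (`I_p = Σ_v [p = Lc•Y + v]`, `A_p = Σ_v [p + e_α = Lc•Y + v]`).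
* §3 `reflDatum_inl_inl` ∕ `_eq_zero_*`: the reflection defect of the datum is the SAME kernel (`hessFFAt_act_apply` + §1).
* §4 **`mixed_consistency`**: the identity, all four axes, all `Y ρ′ w`, as kernels (`funext` over all leg pairs).
Part C (`WardMixedJointModel`) feeds it, with an explicit Ward model, to leaf-04's `ward_stepB` ×4: a JOINT hR∕hW mixed model.
Provenance: D1 formalisation swarm, leaf prover 06 (gen 4), 2026-08-20; the shape of the identity is the owner an2-g20's (journal l.15944); no existing file touched.
-/

noncomputable section

open Finset
open scoped BigOperators
open Literature.MathematicalPhysics.QuantumFieldTheory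
open Literature.MathematicalPhysics.QuantumFieldTheory.Balaban1983to89
open Literature.MathematicalPhysics.QuantumFieldTheory.Balaban1983to89.Beta
open ExpKernelCalculus (MKer comp)
open KernelWard (divV)
open AffineAveraging (Site box toSite unitVec unitVec_apply)
open AveragingContoursRooted (ctr ctrOff ctrOff_mem_box)
open AveragingHessianKernelsRooted (hessFFAt hessFFAt_inl_inl hessFFAt_inl_inr hessFFAt_inr hessFFAt_antisymm)
open OneStepResolventKernel (Fib)
open BalabanStepW2 (M2Of wM1 wM2)
open PolarizationSign (reflSign)
open KernelReflection (LegMap refK refK_apply)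
open ResolventReflection (sref sref_sref sref_sub bref bref_self bref_of_ne Φ Φ_r_inl Φ_r_inr Φ_s_inl Φ_s_inr reflSign_mul_self reflSign_self
  reflSign_of_ne axisReflect_unitVec_self bflip bflip_mem bflip_bflip sum_box_bflip sref_block)
open Summit.QuantumFields.BalabanUV.Beta.TameKernelCalculus
open Summit.QuantumFields.BalabanUV.Beta.ChartConjugation (conjV)
open Summit.QuantumFields.BalabanUV.Beta.BorderedHessian (diagK ctGen ctGen_inl conjV_diagK_apply stepScale)
open Summit.QuantumFields.BalabanUV.Beta.AveragingWardRootedStencils (legInd legInd_inl)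
open Summit.QuantumFields.BalabanUV.Beta.SpineRooted (M1At)
open Summit.QuantumFields.BalabanUV.Beta.KernelWardLevels (stepScale_zero)
open Summit.QuantumFields.BalabanUV.Beta.SecondOrderMixedModel (Dmix Dmix_apply hessFFAt_act_apply)
open Summit.QuantumFields.BalabanUV.Beta.WardBorderReflection (unitVec_eq)
open Summit.QuantumFields.BalabanUV.Beta.WardMixedModelNoGo (sum_ite_and_eq mixedDatum_inl_inl)

namespace Summit.QuantumFields.BalabanUV.Beta.WardMixedConsistency

variable {Lc : ℕ}

/-! ## §1 The block indicator at a reflected field leg -/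

/-- [folklore] **THE BLOCK INDICATOR IS REFLECTION-COVARIANT**: `Σ_{v∈box} [x = sref α (Lc•sref α Y + v)] = Σ_{v∈box} [x = Lc•Y + v]`
(the block of `Y` reflects onto the block of `sref α Y`, offsets flipped: `sref_block`, `sum_box_bflip`). -/
theorem sum_box_indicator_sref (α : Fin (3 + 1)) (x Y : Fin (3 + 1) → ℤ) :
    ∑ v ∈ box (3 + 1) Lc, (if x = sref α ((Lc : ℤ) • sref α Y + toSite v) then (1 : ℝ) else 0) =
      ∑ v ∈ box (3 + 1) Lc, (if x = (Lc : ℤ) • Y + toSite v then (1 : ℝ) else 0) := by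
  rw [← sum_box_bflip α Lc (fun v => if x = (Lc : ℤ) • Y + toSite v then (1 : ℝ) else 0)]
  refine Finset.sum_congr rfl fun v hv => ?_
  have e : sref α ((Lc : ℤ) • sref α Y + toSite v) = (Lc : ℤ) • Y + toSite (bflip α Lc v) := by
    rw [sref_block α hv, sref_sref]
  simp only [e]

/-- [folklore] **… READ AT A REFLECTED FIELD LEG** `bref α β x` against the reflected block: `Σ_v [x = Lc•Y + v]` for `β ≠ α`, and for `β = α`
(the reflected `α`-bond is re-based at its far endpoint) `Σ_v [x + e_α = Lc•Y + v]`. -/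
theorem sum_box_indicator_bref (α β : Fin (3 + 1)) (x Y : Fin (3 + 1) → ℤ) :
    ∑ v ∈ box (3 + 1) Lc, (if bref α β x = (Lc : ℤ) • sref α Y + toSite v then (1 : ℝ) else 0) =
      if β = α then ∑ v ∈ box (3 + 1) Lc, (if x + unitVec α = (Lc : ℤ) • Y + toSite v then (1 : ℝ) else 0)
      else ∑ v ∈ box (3 + 1) Lc, (if x = (Lc : ℤ) • Y + toSite v then (1 : ℝ) else 0) := by
  by_cases hβ : β = α
  · rw [if_pos hβ, hβ, ← sum_box_indicator_sref α (x + unitVec α) Y]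
    refine Finset.sum_congr rfl fun v _ => ?_
    have e : (bref α α x = (Lc : ℤ) • sref α Y + toSite v) ↔ (x + unitVec α = sref α ((Lc : ℤ) • sref α Y + toSite v)) := by
      rw [bref_self]
      constructor
      · intro h
        rw [← h, sref_sub, sref_sref, axisReflect_unitVec_self, sub_neg_eq_add]
      · intro h
        have h2 := congrArg (sref α) h
        rw [sref_sref, ResolventReflection.sref_add, axisReflect_unitVec_self] at h2
        rw [← h2]; abel
    simp only [e]
  · rw [if_neg hβ, bref_of_ne hβ, ← sum_box_indicator_sref α x Y]
    refine Finset.sum_congr rfl fun v _ => ?_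
    have e : (sref α x = (Lc : ℤ) • sref α Y + toSite v) ↔ (x = sref α ((Lc : ℤ) • sref α Y + toSite v)) := by
      constructor
      · intro h; rw [← h, sref_sref]
      · intro h; rw [h, sref_sref]
    simp only [e]

/-! ## §2 The block Ward divergence of the mixed contact `Dmix_α` -/

section Ward

variable [NeZero Lc]

/-- [folklore] Summing `[P κ ∧ β = κ ∧ κ = α]·(−1)` over `κ`: only `κ = α` survives. -/
theorem sum_ite_and_and_eq (P : Fin (3 + 1) → Prop) [DecidablePred P] (β α : Fin (3 + 1)) :
    ∑ κ : Fin (3 + 1), (if P κ ∧ β = κ ∧ κ = α then (-1 : ℝ) else 0) = -(if P α ∧ β = α then 1 else 0) := by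
  rw [Finset.sum_eq_single α]
  · by_cases h : P α ∧ β = α
    · rw [if_pos ⟨h.1, h.2, rfl⟩, if_pos h]
    · rw [if_neg (fun h' => h ⟨h'.1, h'.2.1⟩), if_neg h, neg_zero]
  · exact fun κ _ hκ => if_neg fun ⟨_, _, e⟩ => hκ e
  · exact fun h => absurd (Finset.mem_univ α) h

omit [NeZero Lc] in
/-- [folklore] A constant conjunct factors out of an indicator sum. -/
theorem sum_ite_and_const {ι : Type*} (S : Finset ι) (P : ι → Prop) [DecidablePred P] (Q : Prop) [Decidable Q] :
    ∑ i ∈ S, (if P i ∧ Q then (1 : ℝ) else 0) = if Q then ∑ i ∈ S, (if P i then (1 : ℝ) else 0) else 0 := by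
  by_cases hQ : Q
  · rw [if_pos hQ]; exact Finset.sum_congr rfl fun i _ => by simp [hQ]
  · rw [if_neg hQ]; exact Finset.sum_eq_zero fun i _ => by simp [hQ]

/-- [folklore] **THE FINE DIVERGENCE OF `Dmix_α` IN ITS FLUCTUATION SLOT, ON FIELD LEGS** (every site `s`): with `ĝ^α` read on field legs,
`Σ_κ (Dmix_α κ (s − e_κ) − Dmix_α κ s) x z β β′ = cΛ·(−Lc⁴∕2)·H·(([z = s ∧ β′ = α] − [z + e_α = s ∧ β′ = α]) − ([x = s ∧ β = α] − [x + e_α = s ∧ β = α]))`. -/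
theorem divV_Dmix_inl_inl (cΛ : ℝ) (α ρ' : Fin (3 + 1)) (w s x z : Fin (3 + 1) → ℤ) (β β' : Fin (3 + 1)) :
    divV (fun κ u => wM2 3 Lc 0 • Dmix Lc cΛ α κ u ρ' w) s x z (Sum.inl β) (Sum.inl β') =
      cΛ * (-((Lc : ℝ) ^ 4 / 2)) * hessFFAt (toSite (ctrOff 4 Lc)) Lc ρ' w x z (Sum.inl β) (Sum.inl β') *
        (((if z = s ∧ β' = α then (1 : ℝ) else 0) - (if z + unitVec α = s ∧ β' = α then (1 : ℝ) else 0)) -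
          ((if x = s ∧ β = α then (1 : ℝ) else 0) - (if x + unitVec α = s ∧ β = α then (1 : ℝ) else 0))) := by
  have h0 : wM2 3 Lc 0 = 1 := by simp [BalabanStepW2.wM2]
  simp only [KernelWard.divV, Finset.sum_apply, Pi.sub_apply, Pi.smul_apply, smul_eq_mul, h0, one_mul, Dmix_apply, ctGen_inl, unitVec_eq]
  have ex : ∀ κ : Fin (3 + 1), (x = s - unitVec κ ∧ β = κ ∧ κ = α) ↔ (x + unitVec κ = s ∧ β = κ ∧ κ = α) := fun κ => by
    rw [eq_sub_iff_add_eq]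
  have ez : ∀ κ : Fin (3 + 1), (z = s - unitVec κ ∧ β' = κ ∧ κ = α) ↔ (z + unitVec κ = s ∧ β' = κ ∧ κ = α) := fun κ => by
    rw [eq_sub_iff_add_eq]
  simp only [ex, ez]
  have ha := sum_ite_and_and_eq (fun κ : Fin (3 + 1) => x + unitVec κ = s) β α
  have hb := sum_ite_and_and_eq (fun κ : Fin (3 + 1) => z + unitVec κ = s) β' α
  have hc := sum_ite_and_and_eq (fun _ : Fin (3 + 1) => x = s) β α
  have hd := sum_ite_and_and_eq (fun _ : Fin (3 + 1) => z = s) β' α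
  set H := hessFFAt (toSite (ctrOff 4 Lc)) Lc ρ' w x z (Sum.inl β) (Sum.inl β')
  have e : ∀ κ : Fin (3 + 1),
      cΛ * H * (-((Lc : ℝ) ^ 4 / 2) * (if z + unitVec κ = s ∧ β' = κ ∧ κ = α then (-1 : ℝ) else 0) -
          -((Lc : ℝ) ^ 4 / 2) * (if x + unitVec κ = s ∧ β = κ ∧ κ = α then (-1 : ℝ) else 0)) -
        cΛ * H * (-((Lc : ℝ) ^ 4 / 2) * (if z = s ∧ β' = κ ∧ κ = α then (-1 : ℝ) else 0) -
          -((Lc : ℝ) ^ 4 / 2) * (if x = s ∧ β = κ ∧ κ = α then (-1 : ℝ) else 0)) =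
      cΛ * (-((Lc : ℝ) ^ 4 / 2)) * H * (((if z + unitVec κ = s ∧ β' = κ ∧ κ = α then (-1 : ℝ) else 0) -
          (if x + unitVec κ = s ∧ β = κ ∧ κ = α then (-1 : ℝ) else 0)) -
        ((if z = s ∧ β' = κ ∧ κ = α then (-1 : ℝ) else 0) - (if x = s ∧ β = κ ∧ κ = α then (-1 : ℝ) else 0))) := fun κ => by ring
  rw [Finset.sum_congr rfl fun κ _ => e κ, ← Finset.mul_sum, Finset.sum_sub_distrib, Finset.sum_sub_distrib, Finset.sum_sub_distrib,
    ha, hb, hc, hd]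
  ring

/-- [folklore] **THE BLOCK WARD DIVERGENCE OF `Dmix_α` ON FIELD LEGS**: with `I_p := Σ_v [p = Lc•Y + v]`, `A_p := Σ_v [p + e_α = Lc•Y + v]`,
`((stepScale 0·Lc⁴)⁻¹ • Σ_v divV (κ u ↦ wM2 0 • Dmix_α κ u ρ′ w) (Lc•Y + v)) x z β β′ = (cΛ∕2) · H_{ρ′w} x z β β′ · ([β′ = α](A_z − I_z) − [β = α](A_x − I_x))`. -/
theorem wardOp_Dmix_inl_inl (hLc : 1 ≤ Lc) (cΛ : ℝ) (α : Fin (3 + 1)) (Y : Fin (3 + 1) → ℤ) (ρ' : Fin (3 + 1)) (w x z : Fin (3 + 1) → ℤ)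
    (β β' : Fin (3 + 1)) :
    ((stepScale 3 Lc 0 * (Lc : ℝ) ^ (3 + 1))⁻¹ • ∑ v ∈ box (3 + 1) Lc,
        divV (fun κ u => wM2 3 Lc 0 • Dmix Lc cΛ α κ u ρ' w) ((Lc : ℤ) • Y + toSite v)) x z (Sum.inl β) (Sum.inl β') =
      cΛ / 2 * hessFFAt (toSite (ctrOff 4 Lc)) Lc ρ' w x z (Sum.inl β) (Sum.inl β') *
        ((if β' = α then (∑ v ∈ box (3 + 1) Lc, (if z + unitVec α = (Lc : ℤ) • Y + toSite v then (1 : ℝ) else 0)) -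
            ∑ v ∈ box (3 + 1) Lc, (if z = (Lc : ℤ) • Y + toSite v then (1 : ℝ) else 0) else 0) -
          (if β = α then (∑ v ∈ box (3 + 1) Lc, (if x + unitVec α = (Lc : ℤ) • Y + toSite v then (1 : ℝ) else 0)) -
            ∑ v ∈ box (3 + 1) Lc, (if x = (Lc : ℤ) • Y + toSite v then (1 : ℝ) else 0) else 0)) := by
  classical
  have hL : (Lc : ℝ) ≠ 0 := by exact_mod_cast (show Lc ≠ 0 by omega)
  rw [Pi.smul_apply, Pi.smul_apply, Pi.smul_apply, Pi.smul_apply, smul_eq_mul, Finset.sum_apply, Finset.sum_apply,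
    Finset.sum_apply, Finset.sum_apply]
  simp only [divV_Dmix_inl_inl, stepScale_zero, one_mul]
  rw [← Finset.mul_sum, Finset.sum_sub_distrib, Finset.sum_sub_distrib, Finset.sum_sub_distrib, sum_ite_and_const, sum_ite_and_const,
    sum_ite_and_const, sum_ite_and_const]
  have h4 : (Lc : ℝ) ^ (3 + 1) = (Lc : ℝ) ^ 4 := by norm_num
  rw [h4]
  split_ifs <;> field_simp <;> ring

/-- [folklore] Off the field–field block the mixed contact vanishes: `hessFFAt` lives on the ff block. -/
theorem Dmix_apply_eq_zero (cΛ : ℝ) (α κ : Fin (3 + 1)) (u : Fin (3 + 1) → ℤ) (ρ' : Fin (3 + 1)) (w x z : Fin (3 + 1) → ℤ) {a b : Fib 3}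
    (hab : ∀ x' z' : Fin (3 + 1) → ℤ, hessFFAt (toSite (ctrOff 4 Lc)) Lc ρ' w x' z' a b = 0) :
    Dmix Lc cΛ α κ u ρ' w x z a b = 0 := by
  rw [Dmix_apply, hab, mul_zero, zero_mul]

/-- [folklore] **THE BLOCK WARD DIVERGENCE OF `Dmix_α` VANISHES OFF THE FF BLOCK.** -/
theorem wardOp_Dmix_eq_zero (cΛ : ℝ) (α : Fin (3 + 1)) (Y : Fin (3 + 1) → ℤ) (ρ' : Fin (3 + 1)) (w x z : Fin (3 + 1) → ℤ) {a b : Fib 3}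
    (hab : ∀ x' z' : Fin (3 + 1) → ℤ, hessFFAt (toSite (ctrOff 4 Lc)) Lc ρ' w x' z' a b = 0) :
    ((stepScale 3 Lc 0 * (Lc : ℝ) ^ (3 + 1))⁻¹ • ∑ v ∈ box (3 + 1) Lc,
        divV (fun κ u => wM2 3 Lc 0 • Dmix Lc cΛ α κ u ρ' w) ((Lc : ℤ) • Y + toSite v)) x z a b = 0 := by
  rw [Pi.smul_apply, Pi.smul_apply, Pi.smul_apply, Pi.smul_apply, smul_eq_mul, Finset.sum_apply, Finset.sum_apply,
    Finset.sum_apply, Finset.sum_apply]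
  simp only [KernelWard.divV, Finset.sum_apply, Pi.sub_apply, Pi.smul_apply, smul_eq_mul, Dmix_apply_eq_zero cΛ α _ _ ρ' w _ _ hab,
    mul_zero, sub_zero, Finset.sum_const_zero]

end Ward

/-! ## §3 The reflection defect of the mixed datum `[M1At 0, D_Y]` -/

section Datum

/-- [folklore] **THE REFLECTED MIXED DATUM ON FIELD LEGS** (odd `Lc`): with `I′(p,β) := Σ_v [bref α β p = Lc•sref α Y + v]` (= `A_p` for `β = α`, `I_p` else),
`(ε_α(ρ′) • refK_α ([M1At 0 ρ′ (bref α ρ′ w), D_{sref α Y}])) x z β β′ = cΛ · H_{ρ′w} x z β β′ · (½ I′(z,β′) − ½ I′(x,β))` — an1's pure-sign law `hessFFAt_act_apply`. -/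
theorem reflDatum_inl_inl (hLc : Odd Lc) (cΛ : ℝ) (α : Fin (3 + 1)) (Y : Fin (3 + 1) → ℤ) (ρ' : Fin (3 + 1)) (w x z : Fin (3 + 1) → ℤ)
    (β β' : Fin (3 + 1)) :
    (reflSign α ρ' • refK (Φ (d := 3) Lc α)
        (comp (M1At 3 Lc (toSite (ctrOff (3 + 1) Lc)) cΛ 0 ρ' (bref α ρ' w))
            (diagK (((1 : ℝ) / 2) • ∑ v ∈ box (3 + 1) Lc, legInd (toSite (ctrOff (3 + 1) Lc)) ((Lc : ℤ) • sref α Y + toSite v))) -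
          comp (diagK (((1 : ℝ) / 2) • ∑ v ∈ box (3 + 1) Lc, legInd (toSite (ctrOff (3 + 1) Lc)) ((Lc : ℤ) • sref α Y + toSite v)))
            (M1At 3 Lc (toSite (ctrOff (3 + 1) Lc)) cΛ 0 ρ' (bref α ρ' w)))) x z (Sum.inl β) (Sum.inl β') =
      cΛ * hessFFAt (toSite (ctrOff 4 Lc)) Lc ρ' w x z (Sum.inl β) (Sum.inl β') *
        ((1 / 2) * (if β' = α then ∑ v ∈ box (3 + 1) Lc, (if z + unitVec α = (Lc : ℤ) • Y + toSite v then (1 : ℝ) else 0)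
            else ∑ v ∈ box (3 + 1) Lc, (if z = (Lc : ℤ) • Y + toSite v then (1 : ℝ) else 0)) -
          (1 / 2) * (if β = α then ∑ v ∈ box (3 + 1) Lc, (if x + unitVec α = (Lc : ℤ) • Y + toSite v then (1 : ℝ) else 0)
            else ∑ v ∈ box (3 + 1) Lc, (if x = (Lc : ℤ) • Y + toSite v then (1 : ℝ) else 0))) := by
  have hact := hessFFAt_act_apply hLc α ρ' w x z (Sum.inl β) (Sum.inl β')
  rw [Φ_r_inl, Φ_r_inl, Φ_s_inl, Φ_s_inl] at hact
  rw [Pi.smul_apply, Pi.smul_apply, Pi.smul_apply, Pi.smul_apply, smul_eq_mul, refK_apply, mixedDatum_inl_inl, Φ_r_inl, Φ_r_inl,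
    Φ_s_inl, Φ_s_inl, sum_box_indicator_bref, sum_box_indicator_bref, ← hact]
  ring

/-- [folklore] Off the ff block the mixed datum vanishes (any block index, any second slot). -/
theorem datum_apply_eq_zero (cΛ : ℝ) (Y : Fin (3 + 1) → ℤ) (ρ' : Fin (3 + 1)) (w x z : Fin (3 + 1) → ℤ) {a b : Fib 3}
    (hab : ∀ (w' x' z' : Fin (3 + 1) → ℤ), hessFFAt (toSite (ctrOff 4 Lc)) Lc ρ' w' x' z' a b = 0) :
    (comp (M1At 3 Lc (toSite (ctrOff (3 + 1) Lc)) cΛ 0 ρ' w)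
          (diagK (((1 : ℝ) / 2) • ∑ v ∈ box (3 + 1) Lc, legInd (toSite (ctrOff (3 + 1) Lc)) ((Lc : ℤ) • Y + toSite v))) -
        comp (diagK (((1 : ℝ) / 2) • ∑ v ∈ box (3 + 1) Lc, legInd (toSite (ctrOff (3 + 1) Lc)) ((Lc : ℤ) • Y + toSite v)))
          (M1At 3 Lc (toSite (ctrOff (3 + 1) Lc)) cΛ 0 ρ' w)) x z a b = 0 := by
  change conjV _ (diagK _) x z _ _ = _
  rw [conjV_diagK_apply]
  simp only [SpineRooted.M1At, Pi.smul_apply, smul_eq_mul, hab, mul_zero, zero_mul]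

end Datum

/-! ## §4 The mixed consistency identity -/

section Identity

variable [NeZero Lc]

/-- [folklore] **THE MIXED-SOCKET CONSISTENCY IDENTITY** (odd `Lc`, all four axes `α`, all `Y ρ′ w`; the hypothesis `hC` of leaf-04's
`WardBorderReflection.ward_stepB` ∕ the conclusion of `joint_consistency_necessary` for the MIXED sockets of row D1): the block Ward divergence of the
first-order mixed contact `B_α := Dmix_α` (K-M1; `s = (stepScale 0·Lc⁴)⁻¹`, `c = wM2 0`) EQUALS the reflection defect of the hW mixed datum
`F Y ρ′ w := [M1At 0 ρ′ w, D_Y]`, `D_Y = diagK (½ • Σ_v legInd ρ_c (Lc•Y + v))` — both are `(cΛ∕2)·[H_{ρ′w}, diagK (face layer of axis α)]`. -/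
theorem mixed_consistency (hLc : Odd Lc) (cΛ : ℝ) (α : Fin (3 + 1)) (Y : Fin (3 + 1) → ℤ) (ρ' : Fin (3 + 1)) (w : Fin (3 + 1) → ℤ) :
    (stepScale 3 Lc 0 * (Lc : ℝ) ^ (3 + 1))⁻¹ • ∑ v ∈ box (3 + 1) Lc,
        divV (fun κ u => wM2 3 Lc 0 • Dmix Lc cΛ α κ u ρ' w) ((Lc : ℤ) • Y + toSite v) =
      reflSign α ρ' • refK (Φ (d := 3) Lc α)
          (comp (M1At 3 Lc (toSite (ctrOff (3 + 1) Lc)) cΛ 0 ρ' (bref α ρ' w))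
              (diagK (((1 : ℝ) / 2) • ∑ v ∈ box (3 + 1) Lc, legInd (toSite (ctrOff (3 + 1) Lc)) ((Lc : ℤ) • sref α Y + toSite v))) -
            comp (diagK (((1 : ℝ) / 2) • ∑ v ∈ box (3 + 1) Lc, legInd (toSite (ctrOff (3 + 1) Lc)) ((Lc : ℤ) • sref α Y + toSite v)))
              (M1At 3 Lc (toSite (ctrOff (3 + 1) Lc)) cΛ 0 ρ' (bref α ρ' w))) -
        (comp (M1At 3 Lc (toSite (ctrOff (3 + 1) Lc)) cΛ 0 ρ' w)
            (diagK (((1 : ℝ) / 2) • ∑ v ∈ box (3 + 1) Lc, legInd (toSite (ctrOff (3 + 1) Lc)) ((Lc : ℤ) • Y + toSite v))) -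
          comp (diagK (((1 : ℝ) / 2) • ∑ v ∈ box (3 + 1) Lc, legInd (toSite (ctrOff (3 + 1) Lc)) ((Lc : ℤ) • Y + toSite v)))
            (M1At 3 Lc (toSite (ctrOff (3 + 1) Lc)) cΛ 0 ρ' w)) := by
  have hL1 : 1 ≤ Lc := hLc.pos
  funext x z a b
  rw [Pi.sub_apply, Pi.sub_apply, Pi.sub_apply, Pi.sub_apply]
  rcases a with β | m <;> rcases b with β' | m'
  · -- field–field: the two explicit kernels agree
    rw [wardOp_Dmix_inl_inl hL1, reflDatum_inl_inl hLc, mixedDatum_inl_inl]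
    split_ifs <;> ring
  · -- field–multiplier
    have hab : ∀ (w' x' z' : Fin (3 + 1) → ℤ), hessFFAt (toSite (ctrOff 4 Lc)) Lc ρ' w' x' z' (Sum.inl β) (Sum.inr m') = 0 :=
      fun w' x' z' => hessFFAt_inl_inr _ _ _ _ _ _ _ _
    rw [wardOp_Dmix_eq_zero cΛ α Y ρ' w x z (hab w), datum_apply_eq_zero cΛ Y ρ' w x z hab, Pi.smul_apply, Pi.smul_apply, Pi.smul_apply,
      Pi.smul_apply, refK_apply, datum_apply_eq_zero cΛ _ ρ' _ _ _ hab]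
    simp
  · have hab : ∀ (w' x' z' : Fin (3 + 1) → ℤ), hessFFAt (toSite (ctrOff 4 Lc)) Lc ρ' w' x' z' (Sum.inr m) (Sum.inl β') = 0 :=
      fun w' x' z' => hessFFAt_inr _ _ _ _ _ _ _ _
    rw [wardOp_Dmix_eq_zero cΛ α Y ρ' w x z (hab w), datum_apply_eq_zero cΛ Y ρ' w x z hab, Pi.smul_apply, Pi.smul_apply, Pi.smul_apply,
      Pi.smul_apply, refK_apply, datum_apply_eq_zero cΛ _ ρ' _ _ _ hab]
    simp
  · have hab : ∀ (w' x' z' : Fin (3 + 1) → ℤ), hessFFAt (toSite (ctrOff 4 Lc)) Lc ρ' w' x' z' (Sum.inr m) (Sum.inr m') = 0 :=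
      fun w' x' z' => hessFFAt_inr _ _ _ _ _ _ _ _
    rw [wardOp_Dmix_eq_zero cΛ α Y ρ' w x z (hab w), datum_apply_eq_zero cΛ Y ρ' w x z hab, Pi.smul_apply, Pi.smul_apply, Pi.smul_apply,
      Pi.smul_apply, refK_apply, datum_apply_eq_zero cΛ _ ρ' _ _ _ hab]
    simp

end Identity

end Summit.QuantumFields.BalabanUV.Beta.WardMixedConsistency

end
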